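import Summits.Langlands.Langlands.Theorems.RankMinimalPeeling
import Summits.Langlands.Langlands.Theorems.IrreducibilityBySelfDualityReciprocityUpToIrreducibilityGeometricConstituents
import Summits.Langlands.Langlands.Theorems.IrreducibilityBySelfDualityReciprocityUpToIrreducibilityDeRhamBlocks
import Literature.NumberTheory.Automorphic.TunnellOctahedralGlobal
import Literature.NumberTheory.Automorphic.GLnAdelicStructureProofs
import Literature.NumberTheory.Automorphic.PairLFunctionBaseChangeInduction
import Literature.NumberTheory.GaloisRepresentations.FramedGaloisRepInduce
import Literature.NumberTheory.GaloisRepresentations.InducedAEUnramified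
import Literature.NumberTheory.GaloisRepresentations.IntegralGaloisActionProofs
import Literature.NumberTheory.PAdicHodge.FontainePstInductionSchemataProofs
import HarnessLib

/-!
# Induced-fibre descent: weak base-change DESCENT of avatars along an ARBITRARY finite layer `M/K`
# is IN THE CONE of the root binders `B_w ∧ P ∧ Irr`, modulo ONE automorphic Rankin–Selberg statement
# (cell `decomp-langlands`, lens 4 · g43 · node `InducedFibreDescent`)

Cell `decomp-langlands`, lens 4 (minimal counterexample / extremal reduction), generation 43.
TYPED, NOT FILED (route freeze, D-0186): this file elaborates against the tree as it stands and is meant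
to be landed by the census as a Theorems helper twin; it introduces ONE new `Prop` (`RankinSelbergFibre`)
and closes nothing on the ledger.

## Target, BY NAME
* AvDesc = `Summit.Langlands.Langlands.Theses.RootDecomp1.AvatarDescent` (stmt-Langlands-29149): weak
  base-change descent of semisimple avatars along an ARBITRARY finite layer `M/K` (no normality, no
  solvability), the node of the E-line that dominates the whole descent subtree (CPD 27860, CPD♮, SELF
  27862, ANAB 27861, RSELF 28226, g41 `SpreadSupply`, g42 `ConverseTwistMatching`) — theorem
  `avatarDescent_of_rootBinders : Irr → P → B_w → RSF → AvDesc`; hence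
* E = `Summit.Langlands.Langlands.Theses.RootDecomp1.SemisimpleAvatar` (stmt-Langlands-23598) via the tree's
  rank induction `RankMinimalPeeling.semisimpleAvatar_of_graded` — theorem
  `semisimpleAvatar_of_rootBinders : G → Acc → Irr → P → B_w → RSF → E`;
* CPD = `CyclicLayerPeeling.PrimeCyclicLayerDescent` (27860) and CPD♮ =
  `RankMinimalPeeling.NonSelfTwistedPrimeCyclicLayerDescent` as by-name corollaries.

## The extremal reduction (what g42 left and what dissolves it)
g42 (`ConverseDescent`, CLEARED row 590) put the CYCLIC PRIME layer-descent atom CPD in the cone of the root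
binders modulo Arthur–Clozel's fibre theorem, and named as "genuinely residual" the sectors where no cyclic
structure is available: AvDesc along a non-normal / insoluble layer and the perfect-hull sector.  The
minimal counterexample to AvDesc is therefore `(π, M/K, P, r)` with `M/K` an ARBITRARY finite layer — no
Galois group to average over, no Clifford theory, no fibre theorem (AC Thm. 3.1 is cyclic), no
automorphic descent (non-solvable descent is open).  g43 observes that NONE of this is needed: induction
`Ind_{Γ_M}^{Γ_K}` exists for every finite layer, the root binder `B_w` makes every irreducible geometric
constituent of `Ind r` automorphic over `K`, and the one remaining question — which constituent belongs to
`π` — is decided on the AUTOMORPHIC side by a Rankin–Selberg pole, over `K` and `M` only, where `π` and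
`P` both live.
1. (root binder `Irr` over `M`) the semisimple avatar `r` of the cuspidal L-algebraic `P` is irreducible;
   (root binder `P`, clause (i), over `M`) it is de Rham at `w ∣ ℓ`; it is unramified a.e. by compatibility.
2. (tree) `R := Ind_{Γ_M}^{Γ_K} r` (`FramedGaloisRep.induce`, Serre §3.3) is unramified a.e.
   (`FramedGaloisRep.eventually_isUnramifiedAt_induce`), de Rham at `v ∣ ℓ` for Fontaine's pinned datum
   (`IsDeRhamFramedInduceSchema_holds`, Patrikis 2019 Lemma 7.2.1 / Brinon–Conrad), and has Frobenius
   polynomial `∏_{w ∣ v} P_w(X^{f(w|v)})` at a.e. `v` (`FramedGaloisRep.eventually_hasFrobCharpolyAt_induce`,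
   Neukirch VII (10.4)(iv)), `P_w = ∏_{b ∈ t_{P,w}} (X - ι⁻¹ b⁻¹)` the Satake–Frobenius polynomial of `P`.
3. (tree) `R` has irreducible pinned-geometric constituents `ρ₁, …, ρ_k` of ranks `mᵢ ≥ 1` with
   `det(X - R) = ∏ᵢ det(X - ρᵢ)` (`ReciprocityUpToIrreducibility.exists_geometricConstituents` fed with the
   proved de Rham heredity `stub_deRhamBlocks`, Fontaine Astérisque 223 Prop. 1.5.2).
4. (root binder `B_w` over `K`, at ranks `mᵢ ≤ [M:K]·n`) each `ρᵢ` is the avatar of a cuspidal L-algebraic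
   `σᵢ` on `GL_{mᵢ}(𝔸_K)`.
5. (tree, this file) at a.e. `v`, evaluating at one arithmetic Frobenius and reading through `ι`
   (`map_arithFrobPolyOfSatake_one`, `map_inducedFrobPolynomial`):
   `∏ᵢ det(X - t_{σᵢ,v}⁻¹) = ∏_{w ∣ v} det(X^{f(w|v)} - t_{P,w}⁻¹) = inducedSatakePolynomial v (t_P⁻¹)`,
   i.e. the contragredient Satake data of `σ₁ ⊞ ⋯ ⊞ σ_k` is INDUCED (Arthur–Clozel Ch. 3 Def. 6.1) from the
   contragredient Satake data of `P`, at almost every place.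
6. (NEW piece `RankinSelbergFibre`, closed in print — see its docstring) hence some `σᵢ` has rank `n` and the
   Satake parameters of `π` at almost every place; so `ρ := ρᵢ` is an irreducible, hence semisimple, avatar
   of `π`.  QED AvDesc.  E follows by the tree's rank induction from `G ∧ Acc ∧ GradedAvatarDescent`
   (`GradedAvatarDescent ⟸ AvDesc`, `RankMinimalPeeling.gradedAvatarDescent_of_avatarDescent`).

So AvDesc — for EVERY finite layer, and with it the whole descent subtree of the E-line (CPD, CPD♮, SELF,
ANAB, RSELF, g41 SpreadSupply, g42 CTM) — is NOT an independent open atom: it lies in the cone of the root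
binders `B_w ∧ P ∧ Irr` that `RootDecomp1.closes` already consumes, modulo the single automorphic statement
RSF, which carries no Galois datum and is closed in print by Jacquet–Shalika on `Re s ≥ 1`.  What stays
genuinely residual on the E-line is exactly `G = DarkPrimitiveAvatars` (29147) and `Acc = AccessibleAvatars`
(29148) — the CONSTRUCTION atoms — and the root binders themselves (B_w is summit-hard; the node lowers the
atom count, not the summit).  RSF is sandwiched: `(E ∧ Irr) ⟹ RSF` in print (avatars of the `σᵢ`, `π`, `P`;
`Ind Res ρ_π ≅ ρ_π ⊗ Ind 𝟙 ∋ ρ_π`; Brauer–Nesbitt–Chebotarev and Jordan–Hölder), so RSF adds no strength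
beyond the target.

Precedents for consuming `B_w`/`Irr`/`P` inside the E-subtree: `DetTower.frame_of_host`, g42
`ConverseDescent.primeCyclic_of_converse` (row 590).  Relation to other induction nodes on the bus: lens-2
`WeilRestrictionSplit` (S2 = Clifford descent along a SOLVABLE Weil restriction, needs solvable base change
`S3`), `InsolubleInductionCarving.InsolubleFaithfulDescent` (28043, UPWARD non-solvable base change),
`CyclicDeinductionCarving.InducedPreAvatar` (cyclic, Chebotarev/Brauer–Nesbitt/Clifford), lens-1 g10
`InverseInductionLadder` — none detects the fibre of induction by a Rankin–Selberg pole, and none covers an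
arbitrary (non-normal, insoluble) layer.

## Contents
* §1 `RankinSelbergFibre` (RSF), the one new piece.
* §2 plumbing (no restated tree lemma):
  `map_arithFrobPolyOfSatake_one`, `map_inducedFrobPolynomial`, `inducedSatakePolynomial_eq_inducedFrobPolynomial`.
* §3 kernels: `avatarDescent_of_rootBinders : Irr → P → B_w → RSF → AvDesc`,
  `semisimpleAvatar_of_rootBinders : G → Acc → Irr → P → B_w → RSF → E`, corollaries
  `primeCyclic_of_rootBinders` (CPD), `nonSelfTwisted_of_rootBinders` (CPD♮).

## References
* [JacquetShalikaAJM1981] H. Jacquet, J. Shalika, *On Euler products and the classification of automorphic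
  representations I*, Amer. J. Math. 103 (1981) 499–558: Thm. (5.3) (= (2.1)), Cor. (2.5) (`q^{-1/2} < |t| < q^{1/2}`).
* [JacquetShalikaAJM1981II] part II, ibid. 777–815: Prop. (3.6), Thm. (4.4) and its proof (= (2.2), (2.3)).
* [ArthurClozelAMS120] J. Arthur, L. Clozel, Ann. of Math. Stud. 120 (1989), Ch. 3 §1 (1.1) (weak base
  change), §2 (2.1)–(2.3) (book p. 171), §6 Def. 6.1 with (6.1)–(6.2) (induced Satake data).
* [GetzHahn2024] J. Getz, H. Hahn, *An Introduction to Automorphic Representations*, GTM 300 (2024),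
  Thm. 11.7.1 (analytic properties of Rankin–Selberg L-functions; printed p. 223).
* [Patrikis2019] S. Patrikis, Mem. AMS 1238 (2019), Lemma 7.2.1.  [BrinonConrad2009] Thm. 5.2.1, Prop. 6.3.8.
* [FontaineAsterisque223III] J.-M. Fontaine, Astérisque 223 (1994), exposé III, Prop. 1.5.2.
* [SerreLinearRepresentations1977] §3.3, §7.3; Neukirch, *Algebraic Number Theory*, VII (10.4)(iv).
-/

noncomputable section

set_option linter.dupNamespace false

open scoped NumberField Classical Polynomial
open Filter IsDedekindDomain Field Polynomial
open Literature.NumberTheory.Automorphic Literature.NumberTheory.GaloisRepresentations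
open Summit.Langlands.Langlands.Theses

namespace Summit.Langlands.Langlands.Theorems.InducedFibreDescent

/-! ## §1 The one new piece -/

/-- **RSF — Rankin–Selberg fibre detection** [PRINT: Jacquet–Shalika 1981 I Thm. (5.3) & Cor. (2.5),
II Prop. (3.6) & Thm. (4.4) (method) = Arthur–Clozel Ch. 3 (2.1)–(2.3); all on `Re s ≥ 1`].  Purely
AUTOMORPHIC and complex-analytic — no Galois representation, no `ℓ`, no `ι`.  Let `π` be cuspidal L-algebraic
on `GL_n(𝔸_K)`, `M/K` an ARBITRARY finite extension, `P` cuspidal L-algebraic on `GL_n(𝔸_M)` a weak base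
change of `π` (`t_{P,w} = t_{π,v}^{f(w|v)}` a.e.), and `σ₁, …, σ_k` cuspidal L-algebraic on `GL_{mᵢ}(𝔸_K)`
(`mᵢ ≥ 1`) such that at almost every place `v` of `K` the contragredient Satake data of `σ₁ ⊞ ⋯ ⊞ σ_k` is
induced from that of `P`: `∏ᵢ det(X - t_{σᵢ,v}⁻¹) = ∏_{w ∣ v} det(X^{f(w|v)} - t_{P,w}⁻¹)`
(`inducedSatakePolynomial`, Arthur–Clozel Ch. 3 Def. 6.1).  Then some `σᵢ` has rank `n` and the Satake
parameters of `π` at almost every place.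
PRINT PROOF (on `Re s ≥ 1` only).  Write `x_τ ∈ ℝ` for the real twist making a cuspidal datum `τ` unitary
(`|ω_τ| = |·|^{rank·x_τ}`).  (a) Comparing `|det|` of both sides: `Σᵢ mᵢ x_{σᵢ} = n[M:K] x_π`, `x_P = x_π`,
`Σᵢ mᵢ = n[M:K]`.  (b) WEIGHTS ARE EQUAL: if `x_j := minᵢ x_{σᵢ} < x_π`, the place-by-place identity
`∏ᵢ L^S(s, σ_j × σ̃ᵢ) = L^{S_M}(s, σ_j^{BC} × P̃)` (projection formula `Ind(Res a ⊗ b) = a ⊗ Ind b` on Satake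
data; tree `partialPairL_formalBaseChange_eq_of_satakePolynomial_eq_induced`, `σ_j^{BC}` the FORMAL lift
`t ↦ t^{f(w|v)}`) holds for real `s > 1` with every Euler product absolutely convergent; as `s ↓ 1` the left
side → ∞ (simple pole of `L^S(s, σ_j × σ̃_j)`, (2.3); the other factors sit at unitary arguments `≥ 1` and
are bounded away from `0` by (2.1)/(2.2)) while the right side stays bounded, its unitary argument being
`s + x_π - x_j ≥ 1 + (x_π - x_j) > 1` (Cauchy–Schwarz `|tr A tr B| ≤ (|tr A|² + |tr B|²)/2` against the
positive series `log L(P^u × P̃^u)` and `log L(σ_j^u × σ̃_j^u)`, convergent by (2.1); the inverse-conjugate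
symmetry of unitary Satake data and Cor. (2.5) make the logarithms legitimate) — contradiction; with (a),
`x_{σᵢ} = x_π` for all `i`.  (c) DETECTION: the identity with `π` in place of `σ_j` reads
`∏ᵢ L^S(s, π × σ̃ᵢ) = L^{S_M}(s, P × P̃)` (now `π^{BC} = P` is automorphic); all pairs are unitary after the
common shift; the right side has a simple pole at `s = 1` ((2.3)), so some `L^S(s, π × σ̃ᵢ)` is unbounded as
`s ↓ 1`, which by (2.2) forces `mᵢ = n` and `t_{σᵢ,v} = t_{π,v}` for almost all `v`.  ∎
No meromorphic continuation into `0 < Re s < 1` is used.  Tree carriers of the inputs: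
`JacquetShalika1981_{multipliable_partialPairL, partialPairL_boundary, partialPairL_pole}_repData`
(`PairLFunctionPolesRepData`), `CuspidalAutomorphicRepData.exists_unitary_avatar`,
`exists_contragredient_satake_holds`, `PairLFunctionBaseChangeInduction`; pattern of a typed assembly:
`IsobaricRigidityRepData.lean` (est. 500–700 lines; not typed in this generation).
DOMINATION (print): `(E ∧ Irr) ⟹ RSF` — avatars `ρ_{σᵢ}` (irreducible), `ρ_π`, `ρ_P ≃ ρ_π|_{Γ_M}`; the
hypothesis says `⊕ᵢ ρ_{σᵢ} ≃ (Ind Res ρ_π)^{ss} = (ρ_π ⊗ Ind 𝟙)^{ss} ∋ ρ_π` (Chebotarev + Brauer–Nesbitt), and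
Jordan–Hölder gives `ρ_{σᵢ} ≃ ρ_π` for some `i`.  The L-algebraicity binders are carried only to make this
domination literal; the analytic proof does not use them.
(Sources, cited in prose so that this PRINT binder stays next to its consumer — census G25/G43; the statement is
Literature-typable and may be promoted to a Literature named fact by a typer seat: Jacquet–Shalika, AJM 1981 I,
Thm. (5.3), Cor. (2.5); AJM 1981 II, Prop. (3.6), Thm. (4.4); Arthur–Clozel, AMS-120, Ch. 3 (2.1)–(2.3), Def. 6.1;
Getz–Hahn 2024, Thm. 11.7.1.) -/
def RankinSelbergFibre : Prop :=
  ∀ (K : Type) [Field K] [NumberField K] (n : ℕ) (hcpt : Literature.NumberTheory.Automorphic.isCompact_glFiniteIntegralLevel n K), 0 < n → ∀ (π : Literature.NumberTheory.Automorphic.CuspidalAutomorphicRepData n K hcpt), π.1.IsLAlgebraic → ∀ (M : Type) [Field M] [NumberField M] [Algebra K M] (hM : Literature.NumberTheory.Automorphic.isCompact_glFiniteIntegralLevel n M) (P : Literature.NumberTheory.Automorphic.CuspidalAutomorphicRepData n M hM), P.1.IsLAlgebraic → Literature.NumberTheory.Automorphic.IsWeakBaseChangeLiftAE π.1 P.1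 → ∀ (k : ℕ) (m : Fin k → ℕ) (hm : ∀ i, Literature.NumberTheory.Automorphic.isCompact_glFiniteIntegralLevel (m i) K) (σ : ∀ i, Literature.NumberTheory.Automorphic.CuspidalAutomorphicRepData (m i) K (hm i)), (∀ i, 0 < m i) → (∀ i, (σ i).1.IsLAlgebraic) → (∀ᶠ v : IsDedekindDomain.HeightOneSpectrum (NumberField.RingOfIntegers K) in cofinite, ∃ (α : Fin k → Multiset ℂ) (β : IsDedekindDomain.HeightOneSpectrum (NumberField.RingOfIntegers M) → Multiset ℂ), (∀ i, (σ i).1.HasSatakeParamAt v (α i)) ∧ (∀ w : IsDedekindDomain.HeightOneSpectrum (NumberField.RingOfIntegers M), w.asIdeal.under (NumberField.RingOfIntegers K) = v.asIdeal → P.1.HasSatakeParamAt w (β w)) ∧ ∏ i, Literature.NumberTheory.Automorphic.satakePolynomial ((α i).map (·⁻¹)) = Literature.NumberTheory.Automorphic.inducedSatakePolynomial v (fun w => (β w).map (·⁻¹))) → ∃ i, m i = n ∧ ∀ᶠ v : IsDedekindDomain.HeightOneSpectrum (NumberField.RingOfIntegers K) in cofinite, ∀ α : Multiset ℂ, (σ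 i).1.HasSatakeParamAt v α → π.1.HasSatakeParamAt v α

/-! ## §2 Plumbing lemmas -/

/-- Reading the `m = 1` arithmetic-Frobenius Satake polynomial through `ι`:
`ι (∏_{a ∈ α} (X - ι⁻¹ a⁻¹)) = ∏_{a ∈ α} (X - a⁻¹)`, the Satake polynomial of the inverse
(contragredient) parameter. [folklore] -/
theorem map_arithFrobPolyOfSatake_one {ℓ : ℕ} [Fact ℓ.Prime] (ι : PadicAlgCl ℓ ≃+* ℂ) (q : ℕ)
    (α : Multiset ℂ) :
    (arithFrobPolyOfSatake ι q 1 α).map (ι : PadicAlgCl ℓ ≃+* ℂ).toRingHom =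
      satakePolynomial (α.map (·⁻¹)) := by
  rw [arithFrobPolyOfSatake_one, satakePolynomial, Polynomial.map_multiset_prod, Multiset.map_map,
    Multiset.map_map]
  congr 1
  refine Multiset.map_congr rfl fun a _ => ?_
  simp [Polynomial.map_sub, Polynomial.map_X, Polynomial.map_C]

/-- `Polynomial.map` commutes with the induced Frobenius polynomial. [folklore] -/
theorem map_inducedFrobPolynomial {K M : Type} [Field K] [NumberField K] [Field M] [NumberField M]
    [Algebra K M] {A B : Type*} [CommRing A] [CommRing B] (f : A →+* B)
    (v : HeightOneSpectrum (𝓞 K)) (Q : HeightOneSpectrum (𝓞 M) → A[X]) :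
    (inducedFrobPolynomial v Q).map f = inducedFrobPolynomial v (fun w => (Q w).map f) := by
  classical
  haveI : Fintype {w : HeightOneSpectrum (𝓞 M) // w.under (𝓞 K) = v} :=
    @Fintype.ofFinite _ (finite_heightOneSpectrum_under_eq v)
  rw [inducedFrobPolynomial_eq_prod, inducedFrobPolynomial_eq_prod, Polynomial.map_prod]
  refine Finset.prod_congr rfl fun w _ => ?_
  rw [Polynomial.map_comp, Polynomial.map_pow, Polynomial.map_X]

/-- The induced Satake polynomial IS the induced Frobenius polynomial of the Satake polynomials
(definitional). [folklore] -/
theorem inducedSatakePolynomial_eq_inducedFrobPolynomial {K M : Type} [Field K] [NumberField K]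
    [Field M] [NumberField M] [Algebra K M] (v : HeightOneSpectrum (𝓞 K))
    (γ : HeightOneSpectrum (𝓞 M) → Multiset ℂ) :
    inducedSatakePolynomial v γ = inducedFrobPolynomial v (fun w => satakePolynomial (γ w)) := by
  rw [inducedSatakePolynomial_def, inducedFrobPolynomial_def]

/-! ## §3 The kernel -/

/-- **AvDesc from the root cone.** `Irr → P → B_w → RSF → RootDecomp1.AvatarDescent` (stmt-Langlands-29149):
weak base-change descent of semisimple avatars along an ARBITRARY finite layer `M/K`, from the three ROOT
binders of `RootDecomp1.closes` (`CuspidalAvatarIrreducible` 23601 over `M`, `PadicMemberCompatibility` 17534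
clause (i) over `M`, `WeakGeometricAutomorphy` 17414 over `K` at ranks `≤ [M:K]·n`) and the print-closed
automorphic piece `RankinSelbergFibre`.  Steps 1–6 of the module docstring. [folklore] -/
theorem avatarDescent_of_rootBinders (hIrr : RootDecomp1.CuspidalAvatarIrreducible)
    (hMC : RootDecomp1.PadicMemberCompatibility) (hBw : RootDecomp1.WeakGeometricAutomorphy)
    (hRS : RankinSelbergFibre) : RootDecomp1.AvatarDescent := by
  intro K _ _ n hcpt hn π hπ M _ _ _ hM P hP hBC ℓ _ ι r hrss hrc
  classical
  -- Step 1 (root binder `Irr` over `M`): the semisimple avatar `r` of the cuspidal `P` is irreducible.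
  have hirr : r.toGaloisRep.IsIrreducible := hIrr M n hM hn P hP ℓ ι r hrss hrc
  -- Step 2 (root binder `P`, clause (i), over `M`): `r` is pinned-geometric.
  have hunr : ∀ᶠ w : HeightOneSpectrum (𝓞 M) in cofinite, r.IsUnramifiedAt w :=
    hrc.mono fun w hw => hw.choose_spec.2.1
  have hdR : ∀ (w : HeightOneSpectrum (𝓞 M)) (hw : ((ℓ : ℕ) : 𝓞 M) ∈ w.asIdeal),
      (Literature.NumberTheory.PAdicHodge.fontainePstAdicCompletion w ℓ hw).IsDeRhamFramed
        (r.toLocal w) :=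
    fun w hw => (hMC M n hM hn P hP ℓ ι r hirr hrc w hw).1
  -- Step 3 (tree): `R := Ind_{Γ_M}^{Γ_K} r` is pinned-geometric of rank `[M:K]·n`.
  obtain ⟨d, hd⟩ : ∃ d, Module.finrank K M = d := ⟨_, rfl⟩
  have hdpos : 0 < d := hd ▸ Module.finrank_pos
  have hRunr : ∀ᶠ v : HeightOneSpectrum (𝓞 K) in cofinite, (r.induce K hd).IsUnramifiedAt v :=
    FramedGaloisRep.eventually_isUnramifiedAt_induce K hd r hunr
  have hRdR : ∀ (v : HeightOneSpectrum (𝓞 K)) (hv : ((ℓ : ℕ) : 𝓞 K) ∈ v.asIdeal),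
      (Literature.NumberTheory.PAdicHodge.fontainePstAdicCompletion v ℓ hv).IsDeRhamFramed
        ((r.induce K hd).toLocal v) :=
    Literature.NumberTheory.PAdicHodge.IsDeRhamFramedInduceSchema_holds K M d hd ℓ n r hdR
  -- Step 4 (tree): the Frobenius polynomials of `R` are the induced Frobenius polynomials of `r`,
  -- i.e. of the Satake data `β` of `P` read through `ι`.
  let β : HeightOneSpectrum (𝓞 M) → Multiset ℂ := fun w =>
    if h : SatakeFrobCompatibleAt ι P.1 r w then h.choose else 0
  let Q : HeightOneSpectrum (𝓞 M) → (PadicAlgCl ℓ)[X] := fun w =>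
    arithFrobPolyOfSatake ι w.residueCard 1 (β w)
  have hβ : ∀ᶠ w : HeightOneSpectrum (𝓞 M) in cofinite,
      P.1.HasSatakeParamAt w (β w) ∧ r.HasFrobCharpolyAt w (Q w) := by
    filter_upwards [hrc] with w hw
    have hβw : β w = hw.choose := dif_pos hw
    simp only [Q]
    rw [hβw]
    exact ⟨hw.choose_spec.1, hw.choose_spec.2.2⟩
  have hRfrob : ∀ᶠ v : HeightOneSpectrum (𝓞 K) in cofinite,
      (r.induce K hd).HasFrobCharpolyAt v (inducedFrobPolynomial v Q) :=
    FramedGaloisRep.eventually_hasFrobCharpolyAt_induce K hd r (hβ.mono fun w hw => hw.2)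
  have hβv : ∀ᶠ v : HeightOneSpectrum (𝓞 K) in cofinite, ∀ w : HeightOneSpectrum (𝓞 M),
      w.asIdeal.under (𝓞 K) = v.asIdeal → P.1.HasSatakeParamAt w (β w) := by
    have h1 : ∀ᶠ w : HeightOneSpectrum (𝓞 M) in cofinite, P.1.HasSatakeParamAt w (β w) :=
      hβ.mono fun w hw => hw.1
    rw [Filter.eventually_cofinite] at h1 ⊢
    refine (h1.image fun w => w.under (𝓞 K)).subset fun v hv => ?_
    simp only [Set.mem_setOf_eq, not_forall] at hv
    obtain ⟨w, hw, hbad⟩ := hv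
    exact ⟨w, hbad, HeightOneSpectrum.ext hw⟩
  -- Step 5 (tree): dévissage of `R` into irreducible pinned-geometric constituents `ρc i`.
  have hdn : 0 < d * n := Nat.mul_pos hdpos hn
  obtain ⟨k, m, ρc, -, hρc, hcp, -, -⟩ :=
    ReciprocityUpToIrreducibility.exists_geometricConstituents
      ReciprocityUpToIrreducibility.stub_deRhamBlocks K ℓ (r.induce K hd) hdn ⟨hRunr, hRdR⟩
  -- Step 6 (root binder `B_w` over `K`): each constituent is the avatar of a cuspidal `σ i`.
  have hσex : ∀ i, ∃ σ : CuspidalAutomorphicRepData (m i) K (isCompact_glFiniteIntegralLevel_holds (m i) K),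
      σ.1.IsLAlgebraic ∧ ∀ᶠ v : HeightOneSpectrum (𝓞 K) in cofinite, SatakeFrobCompatibleAt ι σ.1 (ρc i) v :=
    fun i => hBw K (m i) (isCompact_glFiniteIntegralLevel_holds (m i) K) (hρc i).1 ℓ ι (ρc i)
      (hρc i).2.1 (hρc i).2.2
  choose σ hσL hσc using hσex
  have hσc' : ∀ᶠ v : HeightOneSpectrum (𝓞 K) in cofinite, ∀ i, SatakeFrobCompatibleAt ι (σ i).1 (ρc i) v :=
    Filter.eventually_all.2 hσc
  -- Step 7 (tree): at almost every `v`, `∏ᵢ det(X - ι Frob|ρc i) = det(X - ι Frob|Ind r)`, read on the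
  -- complex side: the contragredient Satake data of `⊞ σ i` is induced from that of `P`.
  have hmain : ∀ᶠ v : HeightOneSpectrum (𝓞 K) in cofinite, ∃ (α : Fin k → Multiset ℂ)
      (β' : HeightOneSpectrum (𝓞 M) → Multiset ℂ), (∀ i, (σ i).1.HasSatakeParamAt v (α i)) ∧
      (∀ w : HeightOneSpectrum (𝓞 M), w.asIdeal.under (𝓞 K) = v.asIdeal → P.1.HasSatakeParamAt w (β' w)) ∧
      ∏ i, satakePolynomial ((α i).map (·⁻¹)) = inducedSatakePolynomial v (fun w => (β' w).map (·⁻¹)) := by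
    filter_upwards [hRfrob, hβv, hσc'] with v hvR hvβ hvσ
    choose α hα using hvσ
    refine ⟨α, β, fun i => (hα i).1, hvβ, ?_⟩
    -- the ℓ-adic identity at an arithmetic Frobenius `φ` at a prime `𝔓 ∣ v` of `K̄`
    obtain ⟨𝔓, h𝔓⟩ := v.primesAbove_nonempty
    obtain ⟨φ, hφ⟩ := HeightOneSpectrum.exists_isArithFrobAt_of_mem_primesAbove_holds h𝔓
    have hℓ : inducedFrobPolynomial v Q = ∏ i, arithFrobPolyOfSatake ι v.residueCard 1 (α i) := by
      rw [← hvR 𝔓 h𝔓 φ hφ, hcp φ]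
      exact Finset.prod_congr rfl fun i _ => (hα i).2.2 𝔓 h𝔓 φ hφ
    -- read through `ι`
    have hC := congrArg (Polynomial.map (ι : PadicAlgCl ℓ ≃+* ℂ).toRingHom) hℓ
    rw [Polynomial.map_prod, map_inducedFrobPolynomial] at hC
    simp only [Q, map_arithFrobPolyOfSatake_one] at hC
    rw [inducedSatakePolynomial_eq_inducedFrobPolynomial, ← hC]
  -- Step 8 (the new piece RSF): one of the `σ i` is `π`, up to a.e. Satake data.
  obtain ⟨i, hmi, hSat⟩ := hRS K n hcpt hn π hπ M hM P hP hBC k m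
    (fun i => isCompact_glFiniteIntegralLevel_holds (m i) K) σ (fun i => (hρc i).1) hσL hmain
  -- Step 9: `ρ := ρc i` is a semisimple avatar of `π`.
  subst hmi
  -- irreducible ⟹ semisimple (folklore, inlined: `Representation.IsIrreducible` gives a complemented submodule lattice)
  have hss : (ρc i).toGaloisRep.IsSemisimple := by
    haveI : Representation.IsIrreducible (ρc i).toGaloisRep.toRepresentation := (hρc i).2.1
    change ComplementedLattice _
    infer_instance
  refine ⟨ρc i, hss, ?_⟩
  filter_upwards [hσc i, hSat] with v hv hv'
  obtain ⟨α, hα, hur, hfrob⟩ := hv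
  exact ⟨α, hv' α hα, hur, hfrob⟩

/-- **E from the root cone plus the construction atoms.** `G → Acc → Irr → P → B_w → RSF →
RootDecomp1.SemisimpleAvatar` (stmt-Langlands-23598), through the tree's rank induction
`RankMinimalPeeling.semisimpleAvatar_of_graded` (E at rank `n` from E below `n`, `G`, `Acc` and graded
avatar descent) and `gradedAvatarDescent_of_avatarDescent`.  `G = DarkPrimitiveAvatars` (29147) and
`Acc = AccessibleAvatars` (29148) are themselves consequences of E
(`CyclicDeinductionDarkPrimitiveAvatars.darkPrimitive_of_semisimpleAvatar`, `accessible_of_semisimpleAvatar`):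
they are what remains of the E-line once the descent subtree is in the root cone. [folklore] -/
theorem semisimpleAvatar_of_rootBinders (hG : RootDecomp1.DarkPrimitiveAvatars)
    (hAcc : RootDecomp1.AccessibleAvatars) (hIrr : RootDecomp1.CuspidalAvatarIrreducible)
    (hMC : RootDecomp1.PadicMemberCompatibility) (hBw : RootDecomp1.WeakGeometricAutomorphy)
    (hRS : RankinSelbergFibre) : RootDecomp1.SemisimpleAvatar :=
  RankMinimalPeeling.semisimpleAvatar_of_graded hG hAcc
    (RankMinimalPeeling.gradedAvatarDescent_of_avatarDescent
      (avatarDescent_of_rootBinders hIrr hMC hBw hRS))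

/-- Corollary: CPD (`CyclicLayerPeeling.PrimeCyclicLayerDescent`, stmt-Langlands-27860) from the root
cone and RSF (AvDesc specialised to a cyclic prime layer). [folklore] -/
theorem primeCyclic_of_rootBinders (hIrr : RootDecomp1.CuspidalAvatarIrreducible)
    (hMC : RootDecomp1.PadicMemberCompatibility) (hBw : RootDecomp1.WeakGeometricAutomorphy)
    (hRS : RankinSelbergFibre) : CyclicLayerPeeling.PrimeCyclicLayerDescent := by
  have h := avatarDescent_of_rootBinders hIrr hMC hBw hRS
  intro K _ _ n hcpt hn π hπ M _ _ _ _ _ _ hM P hP hBC ℓ _ ι r hr hrc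
  exact h K n hcpt hn π hπ M hM P hP hBC ℓ ι r hr hrc

/-- Corollary: CPD♮ (`RankMinimalPeeling.NonSelfTwistedPrimeCyclicLayerDescent`). [folklore] -/
theorem nonSelfTwisted_of_rootBinders (hIrr : RootDecomp1.CuspidalAvatarIrreducible)
    (hMC : RootDecomp1.PadicMemberCompatibility) (hBw : RootDecomp1.WeakGeometricAutomorphy)
    (hRS : RankinSelbergFibre) : RankMinimalPeeling.NonSelfTwistedPrimeCyclicLayerDescent :=
  RankMinimalPeeling.nonSelfTwisted_of_primeCyclic (primeCyclic_of_rootBinders hIrr hMC hBw hRS)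

end Summit.Langlands.Langlands.Theorems.InducedFibreDescent
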